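import Summits.Langlands.Langlands.Theses.FunctorialPrimitivitySplit

/-!
# Route FunctorialPrimitivitySplit — Assembly

The assembly item (stmt-Langlands-28169) of the child route `FunctorialPrimitivitySplit` (decomp-langlands lens-2 gen 21 (REV 1); V-R refining child
`--refines route-Langlands-RootDecomp1:SemisimpleAvatar`, 86th cell route) for E = `RootDecomp1.SemisimpleAvatar` (stmt-Langlands-23598):
`PolynomialFunctorTransport → InductionTransport → RestrictionTwistTransport → FunctoriallyPrimitiveAccessible → FunctoriallyPrimitiveDark → Summit.Langlands.Langlands.Theses.RootDecomp1.SemisimpleAvatar`.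

This is literally the type of the route file's sorry-free deciding theorem `Summit.Langlands.Langlands.Theses.FunctorialPrimitivitySplit.closes`.
Nothing here proves `Langlands` (nor the parent piece): the assembly records only that the items of the route, taken together, imply the parent piece
by name.
-/

set_option linter.dupNamespace false -- project-wide option (lakefile weak.linter.dupNamespace); `Summit.Langlands.Langlands` is the mandated namespace

namespace Summit.Langlands.Langlands.Theorems

/-- **Assembly of route FunctorialPrimitivitySplit** (stmt-Langlands-28169):
`PolynomialFunctorTransport → InductionTransport → RestrictionTwistTransport → FunctoriallyPrimitiveAccessible → FunctoriallyPrimitiveDark → Summit.Langlands.Langlands.Theses.RootDecomp1.SemisimpleAvatar`.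
Proof: unfold `Assembly` and apply the route's deciding theorem `Theses.FunctorialPrimitivitySplit.closes`. -/
theorem functorialPrimitivitySplit_assembly_proof :
    Summit.Langlands.Langlands.Theses.FunctorialPrimitivitySplit.Assembly := by
  unfold Summit.Langlands.Langlands.Theses.FunctorialPrimitivitySplit.Assembly
  exact Summit.Langlands.Langlands.Theses.FunctorialPrimitivitySplit.closes

end Summit.Langlands.Langlands.Theorems
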